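import Literature.NumberTheory.EllipticCurves.PadicSeriesEvaluation
import Literature.NumberTheory.EllipticCurves.PAdicPowerSeriesZeros
import Mathlib.Analysis.Normed.Ring.InfiniteSum

/-!
# `TangentCone.EdgeCap` (stmt-BirchSwinnertonDyer-17609), negative-side support:
# fibrewise Strassmann for integral two-variable `p`-adic series

`p`-adic analysis used by `StubRatioInterpolantFalseOfCentralVanishing.lean` (same directory) to show
that the registered stub `stub_ratioInterpolant` of the line `ratio_measure_strassmann` is false as
typed: for an integral `F ∈ ℚ_p⟦X, Y⟧` (`IsPadicInt F`) and `‖x‖ < 1`, the fibre `y ↦ F(x, y)`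
(`padicEval₂`) is the value of the fibre series `Σ_i f_i(x) Y^i ∈ Λ = ℤ_p⟦Y⟧`,
`f_i(x) = Σ_m F_{m,i} x^m` (`padicEval₂_eq_tsum_fibre`), so a fibre vanishing along an injective
sequence of points of the open unit disc vanishes identically (`fibre_eq_zero_of_zeros`; the zeros of
a non-zero element of `Λ` in the open disc of `ℂ_p` are finite, tree theorem
`MemIwasawaRat.finite_setOf_hasSum_zero` = `p`-adic Weierstrass preparation, Lang, *Cyclotomic
Fields I–II*, Ch. 5 §2 Thm. 2.2); the same holds in the weight variable, by transposing the series
(`weightFibre_eq_zero_of_zeros`). The fibre expansion follows layer S of the line file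
`Cruxes/EdgeCap/Lines/ratio_measure_strassmann.lean` (v4), restated (without auxiliary definitions)
because `Cruxes/` files are not importable. No new definitions.
-/

noncomputable section

-- D-0017: single-problem summit, so `Summit.BirchSwinnertonDyer.BirchSwinnertonDyer.…` repeats a
-- namespace BY DESIGN.
set_option linter.dupNamespace false

namespace Summit.BirchSwinnertonDyer.BirchSwinnertonDyer.Theorems.EdgeCap.Negative

open Literature.NumberTheory.EllipticCurves

/-! ## §0 Elementary `p`-adic facts -/

section Elementary

variable (p : ℕ) [Fact p.Prime]

/-- `‖(1 + p)^n − 1‖_p < 1`: the points `u^n − 1` lie in the open unit disc. [folklore] -/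
theorem norm_one_add_pow_sub_one_lt (n : ℕ) : ‖(1 + (p : ℚ_[p])) ^ n - 1‖ < 1 := by
  have hp : ‖(p : ℚ_[p])‖ < 1 := by
    rw [Padic.norm_p]
    exact inv_lt_one_of_one_lt₀ (by exact_mod_cast (Fact.out : p.Prime).one_lt)
  induction n with
  | zero => simp
  | succ n ih =>
    have hrw : (1 + (p : ℚ_[p])) ^ (n + 1) - 1 =
        ((1 + (p : ℚ_[p])) ^ n - 1) + (p : ℚ_[p]) * (1 + (p : ℚ_[p])) ^ n := by ring
    have h1 : ‖(1 + (p : ℚ_[p])) ^ n‖ ≤ 1 := by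
      rw [norm_pow]
      refine pow_le_one₀ (norm_nonneg _) ?_
      calc ‖(1 + (p : ℚ_[p]))‖ ≤ max ‖(1 : ℚ_[p])‖ ‖(p : ℚ_[p])‖ := IsUltrametricDist.norm_add_le_max _ _
        _ ≤ 1 := max_le (by simp) hp.le
    have h2 : ‖(p : ℚ_[p]) * (1 + (p : ℚ_[p])) ^ n‖ < 1 := by
      rw [norm_mul]
      calc ‖(p : ℚ_[p])‖ * ‖(1 + (p : ℚ_[p])) ^ n‖ ≤ ‖(p : ℚ_[p])‖ * 1 :=
            mul_le_mul_of_nonneg_left h1 (norm_nonneg _)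
        _ < 1 := by rw [mul_one]; exact hp
    rw [hrw]
    calc ‖((1 + (p : ℚ_[p])) ^ n - 1) + (p : ℚ_[p]) * (1 + (p : ℚ_[p])) ^ n‖
        ≤ max ‖(1 + (p : ℚ_[p])) ^ n - 1‖ ‖(p : ℚ_[p]) * (1 + (p : ℚ_[p])) ^ n‖ :=
          IsUltrametricDist.norm_add_le_max _ _
      _ < 1 := max_lt ih h2

/-- `n ↦ (1 + p)^n` is injective in `ℚ_p`. [folklore] -/
theorem one_add_pow_injective : Function.Injective fun n : ℕ => (1 + (p : ℚ_[p])) ^ n := by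
  intro a b h
  have h' : (((1 + p) ^ a : ℕ) : ℚ_[p]) = (((1 + p) ^ b : ℕ) : ℚ_[p]) := by push_cast; exact h
  exact Nat.pow_right_injective (by have := (Fact.out : p.Prime).two_le; omega) (Nat.cast_injective h')

/-- `n ↦ (1 + p)^n − 1` is injective in `ℚ_p`. [folklore] -/
theorem one_add_pow_sub_one_injective :
    Function.Injective fun n : ℕ => (1 + (p : ℚ_[p])) ^ n - 1 := fun _ _ h =>
  one_add_pow_injective p (sub_left_injective h)

end Elementary

/-! ## §1 Fibre expansion of an integral two-variable series (after layer S of the line file) -/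

section Fibre

variable {p : ℕ} [Fact p.Prime]

/-- Summability of a family on `Fin 2 →₀ ℕ` dominated by `K ‖u‖^{d 0} ‖v‖^{d 1}`. [folklore] -/
theorem summable_of_le_geometric₂ {u v : ℚ_[p]} (hu : ‖u‖ < 1) (hv : ‖v‖ < 1)
    {f : (Fin 2 →₀ ℕ) → ℚ_[p]} {K : ℝ} (hf : ∀ d, ‖f d‖ ≤ K * (‖u‖ ^ d 0 * ‖v‖ ^ d 1)) :
    Summable f := by
  set e : (Fin 2 →₀ ℕ) ≃ ℕ × ℕ := Finsupp.equivFunOnFinite.trans (finTwoArrowEquiv ℕ) with he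
  have hgeo : Summable fun mn : ℕ × ℕ => ‖u‖ ^ mn.1 * ‖v‖ ^ mn.2 :=
    (summable_geometric_of_lt_one (norm_nonneg _) hu).mul_of_nonneg
      (summable_geometric_of_lt_one (norm_nonneg _) hv) (fun _ => pow_nonneg (norm_nonneg _) _)
      (fun _ => pow_nonneg (norm_nonneg _) _)
  have hgeo' : Summable fun d : Fin 2 →₀ ℕ => ‖u‖ ^ d 0 * ‖v‖ ^ d 1 := by
    have h := (e.summable_iff (f := fun mn : ℕ × ℕ => ‖u‖ ^ mn.1 * ‖v‖ ^ mn.2)).mpr hgeo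
    refine h.congr fun d => ?_
    simp [e, Function.comp]
  exact Summable.of_norm_bounded (hgeo'.mul_left K) fun d => by simpa [mul_assoc] using hf d

/-- The exponents of the monomial index `(m, i)`: weight exponent `m`. [folklore] -/
@[simp] theorem equivFunOnFinite_symm_vec_apply_zero (m i : ℕ) :
    (Finsupp.equivFunOnFinite.symm ![m, i] : Fin 2 →₀ ℕ) 0 = m := by
  simp

/-- The exponents of the monomial index `(m, i)`: cyclotomic exponent `i`. [folklore] -/
@[simp] theorem equivFunOnFinite_symm_vec_apply_one (m i : ℕ) :
    (Finsupp.equivFunOnFinite.symm ![m, i] : Fin 2 →₀ ℕ) 1 = i := by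
  simp

/-- The fibre coefficients `f_i(x) = Σ_m F_{m,i} x^m` are given by convergent series. [folklore] -/
theorem summable_fibreCoeff {F : MvPowerSeries (Fin 2) ℚ_[p]} (hF : IsPadicInt F) {x : ℚ_[p]}
    (hx : ‖x‖ < 1) (i : ℕ) :
    Summable fun m : ℕ => MvPowerSeries.coeff (Finsupp.equivFunOnFinite.symm ![m, i]) F * x ^ m := by
  refine Summable.of_norm_bounded (summable_geometric_of_lt_one (norm_nonneg x) hx) fun m => ?_
  rw [norm_mul, norm_pow]
  exact mul_le_of_le_one_left (pow_nonneg (norm_nonneg x) m) (hF _)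

/-- The fibre coefficients are `p`-adic integers. [folklore] -/
theorem norm_fibreCoeff_le_one {F : MvPowerSeries (Fin 2) ℚ_[p]} (hF : IsPadicInt F) {x : ℚ_[p]}
    (hx : ‖x‖ < 1) (i : ℕ) :
    ‖∑' m : ℕ, MvPowerSeries.coeff (Finsupp.equivFunOnFinite.symm ![m, i]) F * x ^ m‖ ≤ 1 := by
  refine IsUltrametricDist.norm_tsum_le_of_forall_le_of_nonneg zero_le_one fun m => ?_
  rw [norm_mul, norm_pow]
  calc ‖MvPowerSeries.coeff (Finsupp.equivFunOnFinite.symm ![m, i]) F‖ * ‖x‖ ^ m ≤ 1 * 1 := by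
        gcongr
        · exact hF _
        · exact pow_le_one₀ (norm_nonneg x) hx.le
    _ = 1 := one_mul 1

/-- **Fibre expansion**: `F(x, y) = Σ_i f_i(x) y^i` on the open bidisc, `f_i(x) = Σ_m F_{m,i} x^m`
(absolutely convergent rearrangement). [folklore] -/
theorem padicEval₂_eq_tsum_fibre {F : MvPowerSeries (Fin 2) ℚ_[p]} (hF : IsPadicInt F) {x y : ℚ_[p]}
    (hx : ‖x‖ < 1) (hy : ‖y‖ < 1) :
    padicEval₂ F x y =
      ∑' i : ℕ, (∑' m : ℕ, MvPowerSeries.coeff (Finsupp.equivFunOnFinite.symm ![m, i]) F * x ^ m) * y ^ i := by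
  -- the re-indexing `d ↦ (d 1, d 0)` (fibre index FIRST)
  set e : (Fin 2 →₀ ℕ) ≃ ℕ × ℕ :=
    (Finsupp.equivFunOnFinite.trans (finTwoArrowEquiv ℕ)).trans (Equiv.prodComm ℕ ℕ) with he
  have hes : ∀ i m : ℕ, e.symm (i, m) = Finsupp.equivFunOnFinite.symm ![m, i] := by
    intro i m
    ext j
    fin_cases j <;> simp [e]
  set T : (Fin 2 →₀ ℕ) → ℚ_[p] := fun d => MvPowerSeries.coeff d F * (x ^ d 0 * y ^ d 1) with hT
  have hTs : Summable T :=
    summable_of_le_geometric₂ (K := 1) hx hy fun d => by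
      rw [hT, norm_mul, norm_mul, norm_pow, norm_pow, one_mul]
      exact mul_le_of_le_one_left (by positivity) (hF d)
  have hTe : Summable (T ∘ e.symm) := (e.symm.summable_iff).mpr hTs
  have hfib : ∀ i : ℕ, Summable fun m : ℕ => (T ∘ e.symm) (i, m) := by
    intro i
    have h := (summable_fibreCoeff hF hx i).mul_right (y ^ i)
    refine h.congr fun m => ?_
    simp only [Function.comp_apply, hT, hes, equivFunOnFinite_symm_vec_apply_zero,
      equivFunOnFinite_symm_vec_apply_one]
    ring
  unfold padicEval₂
  rw [show (∑' d : Fin 2 →₀ ℕ, MvPowerSeries.coeff d F * (x ^ d 0 * y ^ d 1)) = ∑' d, T d from rfl,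
    ← e.symm.tsum_eq T, show (fun c => T (e.symm c)) = T ∘ e.symm from rfl, hTe.tsum_prod' hfib]
  refine tsum_congr fun i => ?_
  rw [← tsum_mul_right]
  refine tsum_congr fun m => ?_
  simp only [Function.comp_apply, hT, hes, equivFunOnFinite_symm_vec_apply_zero,
    equivFunOnFinite_symm_vec_apply_one]
  ring

end Fibre

/-! ## §2 Strassmann on a fibre: infinitely many zeros kill the fibre -/

section Strassmann

variable {p : ℕ} [Fact p.Prime]

/-- **A fibre with infinitely many zeros vanishes identically.** If `F` is integral, `‖x‖ < 1`, and
`y ↦ F(x, y)` vanishes along an injective sequence of points of the open unit disc of `ℚ_p`, then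
`F(x, y) = 0` for every `‖y‖ < 1`: the fibre series `Σ_i f_i(x) Y^i ∈ Λ` would otherwise have only
finitely many zeros in the open unit disc of `ℂ_p` (`MemIwasawaRat.finite_setOf_hasSum_zero`,
`p`-adic Weierstrass preparation, Lang, *Cyclotomic Fields* Ch. 5 §2 Thm. 2.2). [cite: Lang1990, Ch. 5 §2 Thm. 2.2] -/
theorem fibre_eq_zero_of_zeros (F : MvPowerSeries (Fin 2) ℚ_[p]) (hF : IsPadicInt F)
    {x : ℚ_[p]} (hx : ‖x‖ < 1) {z : ℕ → ℚ_[p]} (hzinj : Function.Injective z)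
    (hz1 : ∀ n, ‖z n‖ < 1) (hz0 : ∀ n, padicEval₂ F x (z n) = 0) :
    ∀ y : ℚ_[p], ‖y‖ < 1 → padicEval₂ F x y = 0 := by
  -- the fibre coefficients and the fibre series `G ∈ Λ`, `L = G ⊗ ℚ_p`
  set f : ℕ → ℚ_[p] := fun i =>
    ∑' m : ℕ, MvPowerSeries.coeff (Finsupp.equivFunOnFinite.symm ![m, i]) F * x ^ m with hf
  have hf1 : ∀ i, ‖f i‖ ≤ 1 := fun i => norm_fibreCoeff_le_one hF hx i
  set G : PowerSeries ℤ_[p] := PowerSeries.mk fun i => ⟨f i, hf1 i⟩ with hG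
  set L : PowerSeries ℚ_[p] := iwasawaToPowerSeries p G with hL
  have hcoeff : ∀ k, PowerSeries.coeff k L = f k := fun k => by
    simp [hL, hG, iwasawaToPowerSeries, PowerSeries.coeff_map, PowerSeries.coeff_mk]
  -- evaluation of the fibre series at a point of the disc
  have hsum : ∀ y : ℚ_[p], ‖y‖ < 1 → HasSum (fun k : ℕ => f k * y ^ k) (padicEval₂ F x y) := by
    intro y hy
    rw [padicEval₂_eq_tsum_fibre hF hx hy]
    exact ((summable_geometric_of_lt_one (norm_nonneg _) hy).of_norm_bounded
      (f := fun k : ℕ => f k * y ^ k) fun k => by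
        rw [norm_mul, norm_pow]
        exact mul_le_of_le_one_left (pow_nonneg (norm_nonneg _) _) (hf1 k)).hasSum
  -- the fibre series is zero
  have hL0 : L = 0 := by
    by_contra hL0
    have hmem : MemIwasawaRat p L := memIwasawaRat_iwasawaToPowerSeries p G
    have hfin := MemIwasawaRat.finite_setOf_hasSum_zero hmem hL0
    set ι : ℚ_[p] →+* ℂ_[p] := algebraMap ℚ_[p] ℂ_[p] with hι
    have hzι : Function.Injective fun n => ι (z n) := fun a b h => hzinj (ι.injective h)
    have hall : ∀ n, ι (z n) ∈ {w : ℂ_[p] | ‖w‖ < 1 ∧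
        HasSum (fun k => algebraMap ℚ_[p] ℂ_[p] (PowerSeries.coeff k L) * w ^ k) 0} := by
      intro n
      refine ⟨?_, ?_⟩
      · show ‖ι (z n)‖ < 1
        rw [hι, norm_algebraMap']; exact hz1 n
      · have hs' := (hsum (z n) (hz1 n)).map ι.toAddMonoidHom (continuous_algebraMap ℚ_[p] ℂ_[p])
        rw [hz0 n, show ι.toAddMonoidHom (0 : ℚ_[p]) = 0 from map_zero _] at hs'
        refine hs'.congr_fun fun k => ?_
        show ι (PowerSeries.coeff k L) * (ι (z n)) ^ k = ι.toAddMonoidHom (f k * (z n) ^ k)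
        rw [hcoeff k]
        simp
    have huniv : (Set.univ : Set ℕ).Finite :=
      (hfin.preimage hzι.injOn).subset fun n _ => hall n
    exact Set.infinite_univ huniv
  intro y hy
  have hfib0 : ∀ i, f i = 0 := fun i => by rw [← hcoeff i, hL0, map_zero]
  rw [← (hsum y hy).tsum_eq]
  simp [hfib0]

/-- The same in the WEIGHT variable: if `x ↦ F(x, y)` vanishes along an injective sequence of points
of the disc, it vanishes at every `‖x‖ < 1` (apply `fibre_eq_zero_of_zeros` to the transposed series
`Fᵀ(X, Y) = F(Y, X)`, which is integral with `Fᵀ(y, x) = F(x, y)`). [folklore] -/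
theorem weightFibre_eq_zero_of_zeros (F : MvPowerSeries (Fin 2) ℚ_[p]) (hF : IsPadicInt F)
    {y : ℚ_[p]} (hy : ‖y‖ < 1) {z : ℕ → ℚ_[p]} (hzinj : Function.Injective z)
    (hz1 : ∀ n, ‖z n‖ < 1) (hz0 : ∀ n, padicEval₂ F (z n) y = 0) :
    ∀ x : ℚ_[p], ‖x‖ < 1 → padicEval₂ F x y = 0 := by
  -- the transposed series
  set sw : (Fin 2 →₀ ℕ) ≃ (Fin 2 →₀ ℕ) := Finsupp.equivCongrLeft (Equiv.swap (0 : Fin 2) 1) with hsw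
  set Ft : MvPowerSeries (Fin 2) ℚ_[p] := fun d => MvPowerSeries.coeff (sw d) F with hFt
  have hcoe : ∀ d, MvPowerSeries.coeff d Ft = MvPowerSeries.coeff (sw d) F := fun d => rfl
  have hsw0 : ∀ d : Fin 2 →₀ ℕ, (sw d) 0 = d 1 := fun d => by
    simp [sw, Finsupp.equivMapDomain_apply, Equiv.symm_swap]
  have hsw1 : ∀ d : Fin 2 →₀ ℕ, (sw d) 1 = d 0 := fun d => by
    simp [sw, Finsupp.equivMapDomain_apply, Equiv.symm_swap]
  have hswsw : ∀ d : Fin 2 →₀ ℕ, sw (sw d) = d := fun d => by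
    ext i
    simp [sw, Finsupp.equivMapDomain_apply, Equiv.symm_swap, Equiv.swap_apply_self]
  have hFt : IsPadicInt Ft := fun d => by rw [hcoe]; exact hF _
  -- `Fᵀ(v, u) = F(u, v)` (re-indexing of the defining `tsum`)
  have heval : ∀ u v : ℚ_[p], padicEval₂ Ft v u = padicEval₂ F u v := by
    intro u v
    unfold padicEval₂
    rw [← sw.tsum_eq (fun d : Fin 2 →₀ ℕ => MvPowerSeries.coeff d Ft * (v ^ d 0 * u ^ d 1))]
    refine tsum_congr fun d => ?_
    rw [hcoe, hswsw, hsw0, hsw1, mul_comm (v ^ d 1)]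
  intro x hx
  rw [← heval]
  exact fibre_eq_zero_of_zeros Ft hFt hy hzinj hz1 (fun n => by rw [heval]; exact hz0 n) x hx

end Strassmann

end Summit.BirchSwinnertonDyer.BirchSwinnertonDyer.Theorems.EdgeCap.Negative
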